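import Literature.Topology.FourManifolds.LefschetzBaseProfileChange
import HarnessLib

/-!
# Rounding the Lefschetz base by `ε‖z‖²` with a diffeomorphism preserving the page angle

Topic `Literature/Topology/FourManifolds`; namespace `Literature.Topology.FourManifolds.LefschetzBase`.
Sequel of `LefschetzBaseProfileChange.lean` (stage 1: `eta ↦ Θ` with `w` conserved) and second
application of the directed isotopy lemma (`RegularFamilyDirectedIsotopy.lean`).  Everything
here is **proved**; the definitions (`yCutoff`, `dP`, `roundingFieldX/Y`, `roundingField`,
`roundingMult`, `roundingFamily`) are auxiliary and explicit, no named fact is introduced.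

**What.**  Stage 2 of the identification of the Lefschetz base with a strictly pseudoconvex
model (base case of `Literature.Geometry.Symplectic.palf_stein_supportedByBoundaryOpenBook`,
design note in `Literature/Geometry/Symplectic/LefschetzSteinRealisationReduction.lean`): for a
profile `Θ` as produced by stage 1 — smooth, `Θ = 0` on `s ≤ 4`, `Θ ≥ eta`, `Θ' ≥ 0`, and
`Θ(s₁) ≤ 1/32`, `Θ' > 0` on `s ≥ s₁` for some `s₁` — and every sufficiently small `ε ≥ 0`
there is a diffeomorphism `Φ` of `ℝ⁴ = ℂ²` with
`Φ {‖w‖² + Θ(‖x‖²) ≤ 1/4} = {‖w‖² + Θ(‖x‖²) + ε‖z‖² ≤ 1/4}` (and the same for the levels)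
under which **`w` is multiplied by a positive function**, `w(Φ z) = r w(z)`, `r > 0`: the
binding `{w = 0}` and every page angle `{w/‖w‖ = c}` are carried into themselves
(`exists_diffeomorph_rounding`).  Adding `ε‖z‖²` is what makes the model strictly
pseudoconvex (the Levi form of `‖w‖² + Θ(‖x‖²)` is only semi-definite).

**How.**  The family `F_τ = ‖w‖² + Θ(‖x‖²) + τε‖z‖² - 1/4` is carried by the ROUNDING FIELD
`Y = (β(‖y‖²) w p̄'(x) - 2‖y‖² x, -2 w ȳ - ȳ x p'(x))` (`p' = (2g+1)x^{2g}`, `β` a cutoff equal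
to `1` for `‖y‖² ≤ 3/20` and to `0` for `‖y‖² ≥ 3/10`), i.e. the sum of the vertical scaling
`(0, -2wȳ)` (`dw = -4‖y‖² w`), the cut-off horizontal scaling `(β w p̄', 0)` (`dw = -β‖p'‖² w`,
needed only near `y = 0`, where it lives over the flat part `‖x‖² < 4`) and the horizontal
field of stage 1 (`dw = 0`, pushing `‖x‖²` down near the binding): altogether
`dw(Y) = -m w`, `m = 4‖y‖² + β‖p'‖² > 0`, so `w` is an eigenfunction and
`RegularFamily.exists_diffeomorph_image_eq_of_field_of_eigen` applies once transversality is
checked: on the zero sets, `dF_τ(Y) = -2m‖w‖² - 4Θ'(‖x‖²)‖x‖²‖y‖² + τε d‖z‖²(Y)` (the cross term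
`Θ' · 2Re(x̄ β w p̄')` vanishes because `β ≠ 0` forces `‖x‖² < 4`, where `Θ' = 0`), the
continuous `h = 2m‖w‖² + 4Θ'‖x‖²‖y‖²` is positive on the compact
`W = {3/16 ≤ ‖w‖² + Θ ≤ 1/4}` (if `w = 0` there then `Θ ≥ 3/16`, so `‖x‖² > s₁`, `Θ' > 0`,
`y² = x^{2g+1} + 1 ≠ 0`), hence `≥ h₀ > 0`, while `|d‖z‖²(Y)| ≤ B` on `{‖w‖² + Θ ≤ 1/4}`; for
`ε ≤ min (1/(16R)) (h₀/(2(B+1)))` the zero sets lie in `W` and `dF_τ(Y) ≤ -h₀/2 < 0`.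
§6 (`exists_diffeomorph_rounding_with`) runs the same proof for an ARBITRARY smooth
perturbation `ε q`, `q ≥ 0`, in place of `ε‖z‖²` — the form needed by the model whose boundary
Reeb field must respect the open book (`q = ‖x‖² + δ χ(‖y‖²)‖y‖²`: no `‖y‖²`-term near the
binding, where the defining function has to stay split in the coordinates `(w, x)`).

## References

* J. Milnor, *Morse theory*, Ann. of Math. Studies 51 (1963), Thm. 3.1. [Milnor1963]
* K. Cieliebak, Ya. Eliashberg, *From Stein to Weinstein and Back*, AMS Coll. Publ. 59 (2012),
  Ch. 2 (`i`-convex = strictly pseudoconvex models; `‖z‖²`). [CieliebakEliashberg2012]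
-/

noncomputable section

open scoped Manifold ContDiff Topology ComplexConjugate
open Set Function Metric Filter

namespace Literature.Topology.FourManifolds

namespace LefschetzBase

/-! ### §1 The cutoff in `‖y‖²`, the derivative `p'(x)`, one more line derivative -/

/-- The cutoff `β(t) = smoothTransition ((3/10 - t)/(3/20))`: smooth, `= 1` for `t ≤ 3/20`,
`= 0` for `t ≥ 3/10`, values in `[0, 1]`. [folklore] -/
def yCutoff (t : ℝ) : ℝ := Real.smoothTransition ((3 / 10 - t) / (3 / 20))

/-- The cutoff is smooth. [folklore] -/
theorem contDiff_yCutoff : ContDiff ℝ ∞ yCutoff :=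
  Real.smoothTransition.contDiff.comp ((contDiff_const.sub contDiff_id).div_const _)

/-- `β = 1` on `t ≤ 3/20`. [folklore] -/
theorem yCutoff_of_le {t : ℝ} (ht : t ≤ 3 / 20) : yCutoff t = 1 :=
  Real.smoothTransition.one_of_one_le (by rw [le_div_iff₀ (by norm_num : (0 : ℝ) < 3 / 20)]; linarith)

/-- `β = 0` on `t ≥ 3/10`. [folklore] -/
theorem yCutoff_of_ge {t : ℝ} (ht : 3 / 10 ≤ t) : yCutoff t = 0 :=
  Real.smoothTransition.zero_of_nonpos (div_nonpos_of_nonpos_of_nonneg (by linarith) (by norm_num))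

/-- `β ≥ 0`. [folklore] -/
theorem yCutoff_nonneg (t : ℝ) : 0 ≤ yCutoff t := Real.smoothTransition.nonneg _

/-- If `β t ≠ 0` then `t < 3/10`. [folklore] -/
theorem lt_of_yCutoff_ne_zero {t : ℝ} (h : yCutoff t ≠ 0) : t < 3 / 10 := by
  by_contra h'
  exact h (yCutoff_of_ge (not_lt.1 h'))

/-- `p'(x) = (2g+1) x^{2g}`, the derivative of `x^{2g+1} + 1`. [folklore] -/
def dP (g : ℕ) (x : ℂ) : ℂ := (2 * g + 1 : ℕ) * x ^ (2 * g)

/-- `p' ∘ cx` is smooth. [folklore] -/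
theorem contDiff_dP_cx (g : ℕ) : ContDiff ℝ ∞ fun z : EuclideanSpace ℝ (Fin 4) => dP g (cx z) :=
  contDiff_const.mul (contDiff_cx.pow _)

/-- `conj ∘ p' ∘ cx` is smooth. [folklore] -/
theorem contDiff_conj_dP_cx (g : ℕ) :
    ContDiff ℝ ∞ fun z : EuclideanSpace ℝ (Fin 4) => conj (dP g (cx z)) := by
  have h : ContDiff ℝ ∞ fun z : EuclideanSpace ℝ (Fin 4) => Complex.conjCLE (dP g (cx z)) :=
    Complex.conjCLE.contDiff.comp (contDiff_dP_cx g)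
  simpa only [Complex.conjCLE_apply] using h

/-- `‖y‖²` along the line `t ↦ p + t (a, b)`: derivative `2 Re(ȳ b)` at `t = 0`. [folklore] -/
theorem hasDerivAt_norm_sq_cy_line (p : EuclideanSpace ℝ (Fin 4)) (a b : ℂ) :
    HasDerivAt (fun t : ℝ => ‖cy (p + t • mk a b)‖ ^ 2) (2 * (conj (cy p) * b).re) 0 := by
  have h : HasDerivAt (fun t : ℝ => cy p + (t : ℂ) * b) (1 * b) 0 :=
    ((hasDerivAt_ofReal' 0).mul_const b).const_add (cy p)
  have h' := hasDerivAt_norm_sq_comp h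
  have hfun : (fun t : ℝ => ‖cy (p + t • mk a b)‖ ^ 2) = fun t : ℝ => ‖cy p + (t : ℂ) * b‖ ^ 2 := by
    funext t; rw [cy_line]
  rw [hfun]
  refine h'.congr_deriv ?_
  simp

/-! ### §2 The rounding field and its multiplier -/

/-- `x`-component of the rounding field: `β(‖y‖²) w p̄'(x) - 2‖y‖² x`. [folklore] -/
def roundingFieldX (g : ℕ) (z : EuclideanSpace ℝ (Fin 4)) : ℂ :=
  (yCutoff (‖cy z‖ ^ 2) : ℂ) * (w g z * conj (dP g (cx z))) - 2 * (conj (cy z) * cy z) * cx z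

/-- `y`-component of the rounding field: `-2 w ȳ - ȳ x p'(x)`. [folklore] -/
def roundingFieldY (g : ℕ) (z : EuclideanSpace ℝ (Fin 4)) : ℂ :=
  -(2 * w g z * conj (cy z)) - conj (cy z) * cx z * dP g (cx z)

/-- **The rounding field** `Y = (β w p̄' - 2‖y‖² x, -2wȳ - ȳ x p')` on `ℝ⁴ = ℂ²`: along it
`w` satisfies `dw(Y) = -(4‖y‖² + β‖p'‖²) w`. [folklore] -/
def roundingField (g : ℕ) (z : EuclideanSpace ℝ (Fin 4)) : EuclideanSpace ℝ (Fin 4) :=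
  mk (roundingFieldX g z) (roundingFieldY g z)

/-- **The multiplier** `m = 4‖y‖² + β(‖y‖²) ‖p'(x)‖²` (`dw(Y) = -m w`). [folklore] -/
def roundingMult (g : ℕ) (z : EuclideanSpace ℝ (Fin 4)) : ℝ :=
  4 * ‖cy z‖ ^ 2 + yCutoff (‖cy z‖ ^ 2) * ‖dP g (cx z)‖ ^ 2

/-- `z ↦ β(‖y‖²)` is smooth. [folklore] -/
theorem contDiff_yCutoff_cy : ContDiff ℝ ∞ fun z : EuclideanSpace ℝ (Fin 4) => yCutoff (‖cy z‖ ^ 2) :=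
  contDiff_yCutoff.comp (contDiff_norm_sq_complex.comp contDiff_cy)

/-- The `x`-component is smooth. [folklore] -/
theorem contDiff_roundingFieldX (g : ℕ) : ContDiff ℝ ∞ (roundingFieldX g) := by
  unfold roundingFieldX
  refine ((Complex.ofRealCLM.contDiff.comp contDiff_yCutoff_cy).mul
    ((contDiff_w g).mul (contDiff_conj_dP_cx g))).sub ?_
  exact (contDiff_const.mul (contDiff_conj_cy.mul contDiff_cy)).mul contDiff_cx

/-- The `y`-component is smooth. [folklore] -/
theorem contDiff_roundingFieldY (g : ℕ) : ContDiff ℝ ∞ (roundingFieldY g) := by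
  unfold roundingFieldY
  exact ((contDiff_const.mul (contDiff_w g)).mul contDiff_conj_cy).neg.sub
    ((contDiff_conj_cy.mul contDiff_cx).mul (contDiff_dP_cx g))

/-- The rounding field is smooth. [folklore] -/
theorem contDiff_roundingField (g : ℕ) : ContDiff ℝ ∞ (roundingField g) :=
  contDiff_mk_comp (contDiff_roundingFieldX g) (contDiff_roundingFieldY g)

/-- The multiplier is continuous. [folklore] -/
theorem continuous_roundingMult (g : ℕ) : Continuous (roundingMult g) := by
  unfold roundingMult
  exact (continuous_const.mul ((continuous_norm.comp contDiff_cy.continuous).pow 2)).add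
    (contDiff_yCutoff_cy.continuous.mul ((continuous_norm.comp (contDiff_dP_cx g).continuous).pow 2))

/-- The multiplier is non-negative. [folklore] -/
theorem roundingMult_nonneg (g : ℕ) (z : EuclideanSpace ℝ (Fin 4)) : 0 ≤ roundingMult g z :=
  add_nonneg (by positivity) (mul_nonneg (yCutoff_nonneg _) (sq_nonneg _))

/-- **The multiplier is positive on `{‖w‖² ≤ 1/4}`**: `m = 0` forces `y = 0`, `β = 1`,
`p'(x) = 0`, i.e. `x = 0` (`g ≥ 1`; impossible for `g = 0`), i.e. `z = 0`, where `w = -1`.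
[folklore] -/
theorem roundingMult_pos (g : ℕ) {z : EuclideanSpace ℝ (Fin 4)} (hw : ‖w g z‖ ^ 2 ≤ 1 / 4) :
    0 < roundingMult g z := by
  by_contra hle
  push Not at hle
  have h1 : 0 ≤ 4 * ‖cy z‖ ^ 2 := by positivity
  have h2 : 0 ≤ yCutoff (‖cy z‖ ^ 2) * ‖dP g (cx z)‖ ^ 2 :=
    mul_nonneg (yCutoff_nonneg _) (sq_nonneg _)
  have hm : roundingMult g z = 4 * ‖cy z‖ ^ 2 + yCutoff (‖cy z‖ ^ 2) * ‖dP g (cx z)‖ ^ 2 := rfl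
  have hy0 : ‖cy z‖ ^ 2 = 0 := by nlinarith
  have hy : cy z = 0 := by
    have : ‖cy z‖ = 0 := pow_eq_zero_iff (n := 2) (by norm_num) |>.1 hy0
    exact norm_eq_zero.1 this
  have hβ : yCutoff (‖cy z‖ ^ 2) = 1 := yCutoff_of_le (by rw [hy0]; norm_num)
  have hP0 : ‖dP g (cx z)‖ ^ 2 = 0 := by
    rw [hβ, one_mul] at h2 hm
    nlinarith
  have hP : dP g (cx z) = 0 := by
    have : ‖dP g (cx z)‖ = 0 := pow_eq_zero_iff (n := 2) (by norm_num) |>.1 hP0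
    exact norm_eq_zero.1 this
  have hx : cx z = 0 := by
    simp only [dP, mul_eq_zero, Nat.cast_eq_zero] at hP
    rcases hP with h | h
    · omega
    · rcases Nat.eq_zero_or_pos g with hg | hg
      · subst hg; simp at h
      · exact pow_eq_zero_iff (n := 2 * g) (by omega) |>.1 h
  have hz : z = 0 := by rw [← mk_cx_cy z, hx, hy, mk_zero]
  have hw1 : w g z = -1 := by subst hz; simp [w, Phi]
  rw [hw1, norm_neg, norm_one] at hw
  norm_num at hw

/-- **`dw(Y) = -m w`**: the derivative of `w` along the rounding field. [folklore] -/
theorem hasDerivAt_w_roundingField (g : ℕ) (z : EuclideanSpace ℝ (Fin 4)) :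
    HasDerivAt (fun t : ℝ => w g (z + t • roundingField g z))
      (-(roundingMult g z : ℂ) * w g z) 0 := by
  have h := hasDerivAt_w_line g z (roundingFieldX g z) (roundingFieldY g z)
  refine h.congr_deriv ?_
  have h1 : conj (cy z) * cy z = (‖cy z‖ : ℂ) ^ 2 := Complex.conj_mul' _
  have h2 : conj (dP g (cx z)) * dP g (cx z) = (‖dP g (cx z)‖ : ℂ) ^ 2 := Complex.conj_mul' _
  have hP : ((2 * g + 1 : ℕ) : ℂ) * cx z ^ (2 * g) = dP g (cx z) := rfl
  rw [hP]
  simp only [roundingFieldX, roundingFieldY, roundingMult]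
  push_cast
  linear_combination (-4 * w g z) * h1 + (-(yCutoff (‖cy z‖ ^ 2) : ℂ) * w g z) * h2

/-- **`dw(Y) = -m w`** on the Fréchet derivative: `w` is an eigenfunction of the rounding field.
[folklore] -/
theorem fderiv_w_roundingField (g : ℕ) (z : EuclideanSpace ℝ (Fin 4)) :
    fderiv ℝ (w g) z (roundingField g z) = (-roundingMult g z) • w g z := by
  have hl : HasDerivAt (fun t : ℝ => z + t • roundingField g z) (roundingField g z) 0 := by
    have h := ((hasDerivAt_id (0 : ℝ)).smul_const (roundingField g z)).const_add z
    rw [one_smul] at h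
    exact h
  have h1 : HasDerivAt (fun t : ℝ => w g (z + t • roundingField g z))
      (fderiv ℝ (w g) z (roundingField g z)) 0 := by
    have h := (((contDiff_w g).differentiable (by simp)) (z + (0 : ℝ) • roundingField g z)).hasFDerivAt.comp_hasDerivAt (0 : ℝ) hl
    rw [zero_smul, add_zero] at h
    exact h
  rw [h1.unique (hasDerivAt_w_roundingField g z), Complex.real_smul]
  push_cast
  ring

/-- `‖w‖²` along the rounding field: derivative `-2 m ‖w‖²`. [folklore] -/
theorem hasDerivAt_norm_sq_w_roundingField (g : ℕ) (z : EuclideanSpace ℝ (Fin 4)) :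
    HasDerivAt (fun t : ℝ => ‖w g (z + t • roundingField g z)‖ ^ 2)
      (-(2 * roundingMult g z * ‖w g z‖ ^ 2)) 0 := by
  have h := hasDerivAt_norm_sq_comp (hasDerivAt_w_roundingField g z)
  rw [zero_smul, add_zero] at h
  refine h.congr_deriv ?_
  have h3 : conj (w g z) * (-(roundingMult g z : ℂ) * w g z) =
      -(((roundingMult g z * ‖w g z‖ ^ 2 : ℝ)) : ℂ) := by
    have h4 : conj (w g z) * w g z = (‖w g z‖ : ℂ) ^ 2 := Complex.conj_mul' _
    push_cast
    linear_combination (-(roundingMult g z : ℂ)) * h4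
  rw [h3, Complex.neg_re, Complex.ofReal_re]
  ring

/-- If the cutoff vanishes, `2 Re(x̄ Y_x) = -4‖x‖²‖y‖²`. [folklore] -/
theorem two_mul_re_roundingFieldX_of_yCutoff_eq_zero (g : ℕ) {z : EuclideanSpace ℝ (Fin 4)}
    (hβ : yCutoff (‖cy z‖ ^ 2) = 0) :
    2 * (conj (cx z) * roundingFieldX g z).re = -(4 * ‖cx z‖ ^ 2 * ‖cy z‖ ^ 2) := by
  have key : conj (cx z) * roundingFieldX g z = -(((2 * ‖cx z‖ ^ 2 * ‖cy z‖ ^ 2 : ℝ)) : ℂ) := by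
    have h1 : conj (cy z) * cy z = (‖cy z‖ : ℂ) ^ 2 := Complex.conj_mul' _
    have h2 : conj (cx z) * cx z = (‖cx z‖ : ℂ) ^ 2 := Complex.conj_mul' _
    simp only [roundingFieldX, hβ]
    push_cast
    linear_combination (-2 * (conj (cx z) * cx z)) * h1 + (-2 * (‖cy z‖ : ℂ) ^ 2) * h2
  rw [key, Complex.neg_re, Complex.ofReal_re]
  ring

/-! ### §3 The rounding family -/

/-- **The rounding family** `F(τ, z) = ‖w‖² + Θ(‖x‖²) + τ ε (‖x‖² + ‖y‖²) - 1/4`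
(`‖x‖² + ‖y‖² = ‖z‖²`, `norm_sq_eq`). [folklore] -/
def roundingFamily (g : ℕ) (Θ : ℝ → ℝ) (ε : ℝ) (q : ℝ × EuclideanSpace ℝ (Fin 4)) : ℝ :=
  ‖w g q.2‖ ^ 2 + Θ (‖cx q.2‖ ^ 2) + q.1 * (ε * (‖cx q.2‖ ^ 2 + ‖cy q.2‖ ^ 2)) - 1 / 4

section Family

variable (g : ℕ) {Θ : ℝ → ℝ} (ε : ℝ)

/-- `F(0, z) = ‖w‖² + Θ(‖x‖²) - 1/4`. [folklore] -/
theorem roundingFamily_zero (z : EuclideanSpace ℝ (Fin 4)) :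
    roundingFamily g Θ ε (0, z) = ‖w g z‖ ^ 2 + Θ (‖cx z‖ ^ 2) - 1 / 4 := by
  simp [roundingFamily]

/-- `F(1, z) = ‖w‖² + Θ(‖x‖²) + ε‖z‖² - 1/4`. [folklore] -/
theorem roundingFamily_one (z : EuclideanSpace ℝ (Fin 4)) :
    roundingFamily g Θ ε (1, z) = ‖w g z‖ ^ 2 + Θ (‖cx z‖ ^ 2) + ε * ‖z‖ ^ 2 - 1 / 4 := by
  simp [roundingFamily, norm_sq_eq z]

/-- `F(τ, z) = ‖w‖² + Θ(‖x‖²) + τε‖z‖² - 1/4`. [folklore] -/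
theorem roundingFamily_apply (τ : ℝ) (z : EuclideanSpace ℝ (Fin 4)) :
    roundingFamily g Θ ε (τ, z) = ‖w g z‖ ^ 2 + Θ (‖cx z‖ ^ 2) + τ * (ε * ‖z‖ ^ 2) - 1 / 4 := by
  simp [roundingFamily, norm_sq_eq z]

/-- The family is smooth when the profile is. [folklore] -/
theorem contDiff_roundingFamily (hΘ : ContDiff ℝ ∞ Θ) : ContDiff ℝ ∞ (roundingFamily g Θ ε) := by
  unfold roundingFamily
  have hs : ContDiff ℝ ∞ fun q : ℝ × EuclideanSpace ℝ (Fin 4) => ‖cx q.2‖ ^ 2 :=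
    contDiff_norm_sq_complex.comp (contDiff_cx.comp contDiff_snd)
  have hs' : ContDiff ℝ ∞ fun q : ℝ × EuclideanSpace ℝ (Fin 4) => ‖cy q.2‖ ^ 2 :=
    contDiff_norm_sq_complex.comp (contDiff_cy.comp contDiff_snd)
  exact ((((contDiff_norm_sq_complex.comp ((contDiff_w g).comp contDiff_snd)).add
    (hΘ.comp hs)).add (contDiff_fst.mul (contDiff_const.mul (hs.add hs')))).sub contDiff_const)

/-- The time derivative: `∂_τ F(τ, z) = ε (‖x‖² + ‖y‖²)`. [folklore] -/
theorem fderiv_roundingFamily_time (hΘ : ContDiff ℝ ∞ Θ) (τ : ℝ) (z : EuclideanSpace ℝ (Fin 4)) :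
    fderiv ℝ (roundingFamily g Θ ε) (τ, z) (1, 0) = ε * (‖cx z‖ ^ 2 + ‖cy z‖ ^ 2) := by
  set c : ℝ := ε * (‖cx z‖ ^ 2 + ‖cy z‖ ^ 2) with hc
  have h1 : HasDerivAt (fun σ : ℝ => roundingFamily g Θ ε (σ, z)) c τ := by
    have h : HasDerivAt (fun σ : ℝ => σ * c) c τ := by simpa using (hasDerivAt_id τ).mul_const c
    exact (h.const_add (‖w g z‖ ^ 2 + Θ (‖cx z‖ ^ 2))).sub_const (1 / 4)
  have hFd : DifferentiableAt ℝ (roundingFamily g Θ ε) (τ, z) :=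
    (contDiff_roundingFamily g ε hΘ).differentiable (by simp) _
  have hcurve : HasDerivAt (fun σ : ℝ => ((σ, z) : ℝ × EuclideanSpace ℝ (Fin 4)))
      ((1 : ℝ), (0 : EuclideanSpace ℝ (Fin 4))) τ :=
    (hasDerivAt_id τ).prodMk (hasDerivAt_const τ z)
  have h2 : HasDerivAt ((roundingFamily g Θ ε) ∘ fun σ : ℝ => ((σ, z) : ℝ × EuclideanSpace ℝ (Fin 4)))
      (fderiv ℝ (roundingFamily g Θ ε) (τ, z) ((1 : ℝ), (0 : EuclideanSpace ℝ (Fin 4)))) τ :=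
    hFd.hasFDerivAt.comp_hasDerivAt τ hcurve
  exact h2.unique h1

/-- **The derivative of `F_τ` along the rounding field**:
`-2m‖w‖² + Θ'(‖x‖²) D_x + τ ε (D_x + D_y)` with `D_x = 2Re(x̄ Y_x)`, `D_y = 2Re(ȳ Y_y)`.
[folklore] -/
theorem hasDerivAt_roundingFamily_roundingField (hΘ : ContDiff ℝ ∞ Θ) (τ : ℝ)
    (z : EuclideanSpace ℝ (Fin 4)) :
    HasDerivAt (fun t : ℝ => roundingFamily g Θ ε (τ, z + t • roundingField g z))
      (-(2 * roundingMult g z * ‖w g z‖ ^ 2) +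
        deriv Θ (‖cx z‖ ^ 2) * (2 * (conj (cx z) * roundingFieldX g z).re) +
        τ * (ε * (2 * (conj (cx z) * roundingFieldX g z).re +
          2 * (conj (cy z) * roundingFieldY g z).re))) 0 := by
  set v := roundingField g z with hv
  have hw := hasDerivAt_norm_sq_w_roundingField g z
  have hx : HasDerivAt (fun t : ℝ => ‖cx (z + t • v)‖ ^ 2)
      (2 * (conj (cx z) * roundingFieldX g z).re) 0 :=
    hasDerivAt_norm_sq_cx_line z (roundingFieldX g z) (roundingFieldY g z)
  have hy : HasDerivAt (fun t : ℝ => ‖cy (z + t • v)‖ ^ 2)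
      (2 * (conj (cy z) * roundingFieldY g z).re) 0 :=
    hasDerivAt_norm_sq_cy_line z (roundingFieldX g z) (roundingFieldY g z)
  have h20 : ‖cx (z + (0 : ℝ) • v)‖ ^ 2 = ‖cx z‖ ^ 2 := by rw [zero_smul, add_zero]
  have hΘ' : HasDerivAt (fun t : ℝ => Θ (‖cx (z + t • v)‖ ^ 2))
      (deriv Θ (‖cx z‖ ^ 2) * (2 * (conj (cx z) * roundingFieldX g z).re)) 0 := by
    have hd : HasDerivAt Θ (deriv Θ (‖cx (z + (0 : ℝ) • v)‖ ^ 2)) (‖cx (z + (0 : ℝ) • v)‖ ^ 2) :=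
      ((hΘ.differentiable (by simp)) _).hasDerivAt
    have h := hd.comp 0 hx
    rwa [h20] at h
  exact ((hw.add hΘ').add (((hx.add hy).const_mul ε).const_mul τ)).sub_const (1 / 4)

/-- The derivative along the rounding field as a value of the Fréchet derivative of `F_τ`.
[folklore] -/
theorem fderiv_roundingFamily_roundingField (hΘ : ContDiff ℝ ∞ Θ) (τ : ℝ)
    (z : EuclideanSpace ℝ (Fin 4)) :
    fderiv ℝ (fun q => roundingFamily g Θ ε (τ, q)) z (roundingField g z) =
      -(2 * roundingMult g z * ‖w g z‖ ^ 2) +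
        deriv Θ (‖cx z‖ ^ 2) * (2 * (conj (cx z) * roundingFieldX g z).re) +
        τ * (ε * (2 * (conj (cx z) * roundingFieldX g z).re +
          2 * (conj (cy z) * roundingFieldY g z).re)) := by
  have hdiff : Differentiable ℝ fun q => roundingFamily g Θ ε (τ, q) :=
    ((contDiff_roundingFamily g ε hΘ).comp (contDiff_const.prodMk contDiff_id)).differentiable
      (by simp)
  exact (hasDerivAt_comp_line hdiff z (roundingField g z)).unique
    (hasDerivAt_roundingFamily_roundingField g ε hΘ τ z)

end Family

/-! ### §4 Geometry of `{‖w‖² + Θ(‖x‖²) ≤ 1/4}` -/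

/-- **Near `y = 0` one is over the flat part**: `‖w‖² ≤ 1/4` and `‖y‖² < 3/10` imply
`‖x‖² < 4` (`‖x‖^{2g+1} = ‖y² - w - 1‖ ≤ 3/10 + 1/2 + 1 < 2 ≤ 2^{2g+1}`). [folklore] -/
theorem norm_sq_cx_lt_four_of_norm_sq_cy_lt (g : ℕ) {z : EuclideanSpace ℝ (Fin 4)}
    (hw : ‖w g z‖ ^ 2 ≤ 1 / 4) (hy : ‖cy z‖ ^ 2 < 3 / 10) : ‖cx z‖ ^ 2 < 4 := by
  have hwn : ‖w g z‖ ≤ 1 / 2 := by nlinarith [norm_nonneg (w g z)]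
  have hx : cx z ^ (2 * g + 1) = cy z ^ 2 - w g z - 1 := by
    simp only [w, Phi]; ring
  have hxn : ‖cx z‖ ^ (2 * g + 1) < 2 := by
    rw [← norm_pow, hx]
    have h1 : ‖cy z ^ 2 - w g z - 1‖ ≤ ‖cy z ^ 2 - w g z‖ + ‖(1 : ℂ)‖ := norm_sub_le _ _
    have h2 : ‖cy z ^ 2 - w g z‖ ≤ ‖cy z ^ 2‖ + ‖w g z‖ := norm_sub_le _ _
    rw [norm_pow] at h2
    rw [norm_one] at h1
    linarith
  by_contra h
  rw [not_lt] at h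
  have hx2 : 2 ≤ ‖cx z‖ := by nlinarith [norm_nonneg (cx z)]
  have : (2 : ℝ) ≤ ‖cx z‖ ^ (2 * g + 1) :=
    calc (2 : ℝ) = 2 ^ 1 := (pow_one _).symm
      _ ≤ 2 ^ (2 * g + 1) := pow_le_pow_right₀ (by norm_num) (by omega)
      _ ≤ ‖cx z‖ ^ (2 * g + 1) := pow_le_pow_left₀ (by norm_num) hx2 _
  linarith

/-- A profile vanishing on `s ≤ 4` has zero derivative on `s < 4`. [folklore] -/
theorem deriv_eq_zero_of_lt_four {Θ : ℝ → ℝ} (hzero : ∀ s, s ≤ 4 → Θ s = 0) {s : ℝ} (hs : s < 4) :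
    deriv Θ s = 0 := by
  have h : HasDerivAt Θ 0 s := by
    refine (hasDerivAt_const s (0 : ℝ)).congr_of_eventuallyEq ?_
    filter_upwards [gt_mem_nhds hs] with u hu
    exact hzero u hu.le
  exact h.deriv

/-- **The cross term vanishes**: on `{‖w‖² ≤ 1/4}`,
`Θ'(‖x‖²) · 2Re(x̄ Y_x) = Θ'(‖x‖²) · (-4‖x‖²‖y‖²)` — either the cutoff vanishes and
`Y_x = -2‖y‖² x`, or `‖y‖² < 3/10`, hence `‖x‖² < 4` and `Θ' = 0`. [folklore] -/
theorem deriv_mul_two_mul_re_roundingFieldX (g : ℕ) {Θ : ℝ → ℝ} (hzero : ∀ s, s ≤ 4 → Θ s = 0)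
    {z : EuclideanSpace ℝ (Fin 4)} (hw : ‖w g z‖ ^ 2 ≤ 1 / 4) :
    deriv Θ (‖cx z‖ ^ 2) * (2 * (conj (cx z) * roundingFieldX g z).re) =
      deriv Θ (‖cx z‖ ^ 2) * (-(4 * ‖cx z‖ ^ 2 * ‖cy z‖ ^ 2)) := by
  by_cases hβ : yCutoff (‖cy z‖ ^ 2) = 0
  · rw [two_mul_re_roundingFieldX_of_yCutoff_eq_zero g hβ]
  · have hy : ‖cy z‖ ^ 2 < 3 / 10 := lt_of_yCutoff_ne_zero hβ
    have hx : ‖cx z‖ ^ 2 < 4 := norm_sq_cx_lt_four_of_norm_sq_cy_lt g hw hy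
    rw [deriv_eq_zero_of_lt_four hzero hx, zero_mul, zero_mul]

/-- **Positivity of `h = 2m‖w‖² + 4Θ'‖x‖²‖y‖²` on `W = {3/16 ≤ ‖w‖² + Θ ≤ 1/4}`.**
[folklore] -/
theorem h_pos (g : ℕ) {Θ : ℝ → ℝ} (hzero : ∀ s, s ≤ 4 → Θ s = 0) (hnonneg : ∀ s, 0 ≤ Θ s)
    (hmono : Monotone Θ) (hderiv : ∀ s, 0 ≤ deriv Θ s) {s₁ : ℝ} (hs₁ : Θ s₁ ≤ 1 / 32)
    (hpos : ∀ s, s₁ ≤ s → 0 < deriv Θ s) {z : EuclideanSpace ℝ (Fin 4)}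
    (hle : ‖w g z‖ ^ 2 + Θ (‖cx z‖ ^ 2) ≤ 1 / 4) (hge : 3 / 16 ≤ ‖w g z‖ ^ 2 + Θ (‖cx z‖ ^ 2)) :
    0 < 2 * roundingMult g z * ‖w g z‖ ^ 2 +
      4 * deriv Θ (‖cx z‖ ^ 2) * ‖cx z‖ ^ 2 * ‖cy z‖ ^ 2 := by
  have hw : ‖w g z‖ ^ 2 ≤ 1 / 4 := by linarith [hnonneg (‖cx z‖ ^ 2)]
  have hm : 0 < roundingMult g z := roundingMult_pos g hw
  have h2 : 0 ≤ 4 * deriv Θ (‖cx z‖ ^ 2) * ‖cx z‖ ^ 2 * ‖cy z‖ ^ 2 := by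
    have := hderiv (‖cx z‖ ^ 2); positivity
  by_cases hw0 : w g z = 0
  · -- on the central page: `Θ ≥ 3/16`, so `‖x‖² > s₁`, `‖x‖² > 4`, `y ≠ 0`
    have hΘ : 3 / 16 ≤ Θ (‖cx z‖ ^ 2) := by rw [hw0, norm_zero] at hge; simpa using hge
    have hs : s₁ < ‖cx z‖ ^ 2 := by
      by_contra h
      have := hmono (not_lt.1 h)
      linarith
    have hx4 : 4 < ‖cx z‖ ^ 2 := by
      by_contra h
      have := hzero _ (not_lt.1 h)
      linarith
    have hd : 0 < deriv Θ (‖cx z‖ ^ 2) := hpos _ hs.le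
    have hx2 : 2 < ‖cx z‖ := by nlinarith [norm_nonneg (cx z)]
    have hx1 : 1 ≤ ‖cx z‖ := by linarith
    have hy2 : cy z ^ 2 = cx z ^ (2 * g + 1) + 1 := by
      have : w g z = cy z ^ 2 - cx z ^ (2 * g + 1) - 1 := by simp [w, Phi]
      rw [this] at hw0
      linear_combination hw0
    have hyn : 1 < ‖cy z‖ ^ 2 := by
      rw [← norm_pow, hy2]
      have hpow : ‖cx z‖ ≤ ‖cx z‖ ^ (2 * g + 1) := by
        calc ‖cx z‖ = ‖cx z‖ ^ 1 := (pow_one _).symm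
          _ ≤ ‖cx z‖ ^ (2 * g + 1) := pow_le_pow_right₀ hx1 (by omega)
      have h3 : ‖cx z ^ (2 * g + 1)‖ ≤ ‖cx z ^ (2 * g + 1) + 1‖ + ‖(1 : ℂ)‖ := by
        have := norm_sub_le (cx z ^ (2 * g + 1) + 1) 1
        rwa [add_sub_cancel_right] at this
      rw [norm_pow, norm_one] at h3
      linarith
    have hxpos : 0 < ‖cx z‖ ^ 2 := by positivity
    have hypos : 0 < ‖cy z‖ ^ 2 := by linarith
    have h3 : 0 < 4 * deriv Θ (‖cx z‖ ^ 2) * ‖cx z‖ ^ 2 * ‖cy z‖ ^ 2 := by positivity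
    have h4 : 0 ≤ 2 * roundingMult g z * ‖w g z‖ ^ 2 := by positivity
    linarith
  · have hwpos : 0 < ‖w g z‖ ^ 2 := by positivity
    have h1 : 0 < 2 * roundingMult g z * ‖w g z‖ ^ 2 := by positivity
    linarith

/-! ### §5 The rounding -/

/-- **Rounding the base by `ε‖z‖²` while multiplying `w` by a positive function.**  Let
`Θ : ℝ → ℝ` be smooth with `Θ = 0` on `s ≤ 4`, `Θ ≥ eta`, `Θ' ≥ 0`, and suppose
`Θ(s₁) ≤ 1/32` and `Θ' > 0` on `s ≥ s₁` for some `s₁`.  Then there is `ε₀ > 0` such that for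
every `ε ∈ [0, ε₀]` some diffeomorphism `Φ` of `ℝ⁴ = ℂ²` satisfies
`Φ {‖w‖² + Θ(‖x‖²) ≤ 1/4} = {‖w‖² + Θ(‖x‖²) + ε‖z‖² ≤ 1/4}`,
`Φ {‖w‖² + Θ(‖x‖²) = 1/4} = {‖w‖² + Θ(‖x‖²) + ε‖z‖² = 1/4}`, and `w(Φ z) = r w(z)` with
`r > 0` for every `z` (so `Φ` preserves the binding `{w = 0}` and the page angle `w/‖w‖`);
moreover `1/4` is a regular value of the rounded function `‖w‖² + Θ(‖x‖²) + ε‖z‖²` (so that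
`{‖w‖² + Θ(‖x‖²) + ε‖z‖² ≤ 1/4}` is a `RegularSublevel`).
Proof: `RegularFamily.exists_diffeomorph_image_eq_of_field_of_eigen` for the family
`roundingFamily g Θ ε`, the field `roundingField g` and the eigenfunction `w`
(`dw(Y) = -m w`), transversality from `h_pos` by compactness. [folklore] -/
theorem exists_diffeomorph_rounding (g : ℕ) {Θ : ℝ → ℝ} (hΘ : ContDiff ℝ ∞ Θ)
    (hzero : ∀ s, s ≤ 4 → Θ s = 0) (hge : ∀ s, eta s ≤ Θ s) (hderiv : ∀ s, 0 ≤ deriv Θ s)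
    {s₁ : ℝ} (hs₁ : Θ s₁ ≤ 1 / 32) (hpos : ∀ s, s₁ ≤ s → 0 < deriv Θ s) :
    ∃ ε₀ : ℝ, 0 < ε₀ ∧ ∀ ε : ℝ, 0 ≤ ε → ε ≤ ε₀ →
      IsRegularLevel (𝓡 4) (fun z => ‖w g z‖ ^ 2 + Θ (‖cx z‖ ^ 2) + ε * ‖z‖ ^ 2) (1 / 4) ∧
      ∃ Φ : EuclideanSpace ℝ (Fin 4) ≃ₘ⟮𝓘(ℝ, EuclideanSpace ℝ (Fin 4)),
          𝓘(ℝ, EuclideanSpace ℝ (Fin 4))⟯ EuclideanSpace ℝ (Fin 4),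
        Φ '' {z | ‖w g z‖ ^ 2 + Θ (‖cx z‖ ^ 2) ≤ 1 / 4} =
            {z | ‖w g z‖ ^ 2 + Θ (‖cx z‖ ^ 2) + ε * ‖z‖ ^ 2 ≤ 1 / 4} ∧
          Φ '' {z | ‖w g z‖ ^ 2 + Θ (‖cx z‖ ^ 2) = 1 / 4} =
            {z | ‖w g z‖ ^ 2 + Θ (‖cx z‖ ^ 2) + ε * ‖z‖ ^ 2 = 1 / 4} ∧
          ∀ z, ∃ r : ℝ, 0 < r ∧ w g (Φ z) = (r : ℂ) * w g z := by
  have hnonneg : ∀ s, 0 ≤ Θ s := fun s => (eta_nonneg s).trans (hge s)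
  have hmono : Monotone Θ := monotone_of_deriv_nonneg (hΘ.differentiable (by simp)) hderiv
  -- the compact sets `Ω₀ = {‖w‖² + Θ ≤ 1/4} ⊆ {rho ≤ 1/4}` and `W = Ω₀ ∩ {3/16 ≤ ‖w‖² + Θ}`
  set G : EuclideanSpace ℝ (Fin 4) → ℝ := fun z => ‖w g z‖ ^ 2 + Θ (‖cx z‖ ^ 2) with hG
  have hGc : Continuous G :=
    ((continuous_norm.comp (contDiff_w g).continuous).pow 2).add
      (hΘ.continuous.comp ((continuous_norm.comp contDiff_cx.continuous).pow 2))
  have hGρ : ∀ z, rho g z ≤ G z := fun z => by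
    simp only [hG, rho]; linarith [hge (‖cx z‖ ^ 2)]
  set Ω₀ : Set (EuclideanSpace ℝ (Fin 4)) := {z | G z ≤ 1 / 4} with hΩ₀
  have hΩ₀sub : Ω₀ ⊆ rho g ⁻¹' Iic (1 / 4) := fun z hz => (hGρ z).trans hz
  have hΩ₀c : IsCompact Ω₀ :=
    (isCompact_rho_le g).of_isClosed_subset (isClosed_le hGc continuous_const) hΩ₀sub
  set W : Set (EuclideanSpace ℝ (Fin 4)) := Ω₀ ∩ {z | 3 / 16 ≤ G z} with hW
  have hWc : IsCompact W := hΩ₀c.inter_right (isClosed_le continuous_const hGc)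
  -- `h = 2m‖w‖² + 4Θ'‖x‖²‖y‖²` and its positive lower bound on `W`
  set h : EuclideanSpace ℝ (Fin 4) → ℝ := fun z => 2 * roundingMult g z * ‖w g z‖ ^ 2 +
    4 * deriv Θ (‖cx z‖ ^ 2) * ‖cx z‖ ^ 2 * ‖cy z‖ ^ 2 with hh
  have hhc : Continuous h := by
    have h1 : Continuous fun z : EuclideanSpace ℝ (Fin 4) => ‖cx z‖ ^ 2 :=
      (continuous_norm.comp contDiff_cx.continuous).pow 2
    have h2 : Continuous fun z : EuclideanSpace ℝ (Fin 4) => ‖cy z‖ ^ 2 :=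
      (continuous_norm.comp contDiff_cy.continuous).pow 2
    exact ((continuous_const.mul (continuous_roundingMult g)).mul
      ((continuous_norm.comp (contDiff_w g).continuous).pow 2)).add
      (((continuous_const.mul ((hΘ.continuous_deriv (by simp)).comp h1)).mul h1).mul h2)
  have hhW : ∀ z ∈ W, 0 < h z := fun z hz =>
    h_pos g hzero hnonneg hmono hderiv hs₁ hpos hz.1 hz.2
  obtain ⟨h₀, hh₀, hh₀W⟩ : ∃ h₀, 0 < h₀ ∧ ∀ z ∈ W, h₀ ≤ h z := by
    by_cases hne : W.Nonempty
    · obtain ⟨z₀, hz₀, hmin⟩ := hWc.exists_isMinOn hne hhc.continuousOn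
      exact ⟨h z₀, hhW z₀ hz₀, fun z hz => hmin hz⟩
    · exact ⟨1, one_pos, fun z hz => (hne ⟨z, hz⟩).elim⟩
  -- the bound for `d‖z‖²(Y)` on `Ω₀`
  set D : EuclideanSpace ℝ (Fin 4) → ℝ := fun z => 2 * (conj (cx z) * roundingFieldX g z).re +
    2 * (conj (cy z) * roundingFieldY g z).re with hD
  have hDc : Continuous D := by
    have hcx : Continuous fun z : EuclideanSpace ℝ (Fin 4) => conj (cx z) :=
      Complex.continuous_conj.comp contDiff_cx.continuous
    exact (continuous_const.mul (Complex.continuous_re.comp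
      (hcx.mul (contDiff_roundingFieldX g).continuous))).add
      (continuous_const.mul (Complex.continuous_re.comp
        (contDiff_conj_cy.continuous.mul (contDiff_roundingFieldY g).continuous)))
  obtain ⟨B', hB'⟩ : ∃ B, ∀ z ∈ Ω₀, ‖D z‖ ≤ B :=
    hΩ₀c.exists_bound_of_continuousOn hDc.continuousOn
  set B : ℝ := max B' 0 with hBdef
  have hB : ∀ z ∈ Ω₀, ‖D z‖ ≤ B := fun z hz => (hB' z hz).trans (le_max_left _ _)
  have hB0 : 0 ≤ B := le_max_right _ _
  -- a priori bound `‖z‖² ≤ R₀` on `Ω₀`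
  set R₀ : ℝ := 8 + (3 : ℝ) ^ (4 * g + 2) with hR₀
  have hR₀ : 0 < R₀ := by positivity
  have hR : ∀ z ∈ Ω₀, ‖z‖ ^ 2 ≤ R₀ := fun z hz => norm_sq_le_of_rho_le g (hΩ₀sub hz)
  -- the threshold
  set ε₀ : ℝ := min (1 / (16 * R₀)) (h₀ / (2 * (B + 1))) with hε₀
  have hε₀pos : 0 < ε₀ := lt_min (by positivity) (by positivity)
  refine ⟨ε₀, hε₀pos, fun ε hε hεε₀ => ?_⟩
  have hε1 : ε ≤ 1 / (16 * R₀) := hεε₀.trans (min_le_left _ _)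
  have hε2 : ε ≤ h₀ / (2 * (B + 1)) := hεε₀.trans (min_le_right _ _)
  -- the data of the directed isotopy lemma
  set F := roundingFamily g Θ ε with hFdef
  have hF : ContDiff ℝ ∞ F := contDiff_roundingFamily g ε hΘ
  have hY : ContDiff ℝ ∞ (roundingField g) := contDiff_roundingField g
  have hKc : IsCompact (rho g ⁻¹' Iic (3 / 8)) := isCompact_rho_le_three_eighths g
  have hband : (0 : ℝ) < 1 / 8 := by norm_num
  have hKF : ∀ τ ∈ Icc (0 : ℝ) 1, ∀ z, |F (τ, z)| ≤ 1 / 8 → z ∈ rho g ⁻¹' Iic (3 / 8) := by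
    intro τ hτ z hz
    have h1 := (abs_le.1 hz).2
    rw [hFdef, roundingFamily_apply] at h1
    have h2 : 0 ≤ τ * (ε * ‖z‖ ^ 2) := mul_nonneg hτ.1 (mul_nonneg hε (sq_nonneg _))
    have h3 := hGρ z
    show rho g z ≤ 3 / 8
    simp only [hG] at h3
    linarith
  have hreg : ∀ τ ∈ Icc (0 : ℝ) 1, ∀ z, F (τ, z) = 0 →
      fderiv ℝ (fun q => F (τ, q)) z (roundingField g z) ≠ 0 := by
    intro τ hτ z hz0
    have hFz : ‖w g z‖ ^ 2 + Θ (‖cx z‖ ^ 2) + τ * (ε * ‖z‖ ^ 2) - 1 / 4 = 0 := by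
      rw [hFdef, roundingFamily_apply] at hz0; exact hz0
    have hτε : 0 ≤ τ * (ε * ‖z‖ ^ 2) := mul_nonneg hτ.1 (mul_nonneg hε (sq_nonneg _))
    have hzΩ : z ∈ Ω₀ := by
      show ‖w g z‖ ^ 2 + Θ (‖cx z‖ ^ 2) ≤ 1 / 4
      linarith
    have hzR : ‖z‖ ^ 2 ≤ R₀ := hR z hzΩ
    have hsmall : τ * (ε * ‖z‖ ^ 2) ≤ 1 / 16 := by
      have h1 : τ * (ε * ‖z‖ ^ 2) ≤ 1 * (ε * ‖z‖ ^ 2) :=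
        mul_le_mul_of_nonneg_right hτ.2 (mul_nonneg hε (sq_nonneg _))
      have h2 : ε * ‖z‖ ^ 2 ≤ 1 / (16 * R₀) * R₀ :=
        mul_le_mul hε1 hzR (sq_nonneg _) (by positivity)
      have h3 : 1 / (16 * R₀) * R₀ = 1 / 16 := by field_simp
      linarith
    have hzW : z ∈ W := by
      refine ⟨hzΩ, ?_⟩
      show 3 / 16 ≤ ‖w g z‖ ^ 2 + Θ (‖cx z‖ ^ 2)
      linarith
    have hw : ‖w g z‖ ^ 2 ≤ 1 / 4 := by linarith [hnonneg (‖cx z‖ ^ 2)]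
    rw [hFdef, fderiv_roundingFamily_roundingField g ε hΘ τ z,
      deriv_mul_two_mul_re_roundingFieldX g hzero hw]
    have hhz : h₀ ≤ h z := hh₀W z hzW
    have hDz : |D z| ≤ B := by simpa [Real.norm_eq_abs] using hB z hzΩ
    have hDle : D z ≤ B := (le_abs_self _).trans hDz
    have hτD : τ * (ε * D z) ≤ ε * B := by
      have h1 : ε * D z ≤ ε * B := mul_le_mul_of_nonneg_left hDle hε
      rcases le_or_gt 0 (ε * D z) with h0 | h0
      · calc τ * (ε * D z) ≤ 1 * (ε * D z) := mul_le_mul_of_nonneg_right hτ.2 h0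
          _ ≤ ε * B := by linarith
      · have : τ * (ε * D z) ≤ 0 := mul_nonpos_of_nonneg_of_nonpos hτ.1 h0.le
        have : 0 ≤ ε * B := mul_nonneg hε hB0
        linarith
    have hεB : ε * B ≤ h₀ / 2 := by
      have h1 : ε * B ≤ h₀ / (2 * (B + 1)) * B := mul_le_mul_of_nonneg_right hε2 hB0
      have h2 : h₀ / (2 * (B + 1)) * B ≤ h₀ / (2 * (B + 1)) * (B + 1) :=
        mul_le_mul_of_nonneg_left (by linarith) (by positivity)
      have h3 : h₀ / (2 * (B + 1)) * (B + 1) = h₀ / 2 := by field_simp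
      linarith
    have hval : -(2 * roundingMult g z * ‖w g z‖ ^ 2) +
        deriv Θ (‖cx z‖ ^ 2) * -(4 * ‖cx z‖ ^ 2 * ‖cy z‖ ^ 2) +
        τ * (ε * (2 * (conj (cx z) * roundingFieldX g z).re +
          2 * (conj (cy z) * roundingFieldY g z).re)) = -h z + τ * (ε * D z) := by
      simp only [hh, hD]; ring
    rw [hval]
    linarith
  have hfY : ∀ z, fderiv ℝ (w g) z (roundingField g z) = (-roundingMult g z) • w g z :=
    fderiv_w_roundingField g
  obtain ⟨Φ, hle, heq, -, -, heig⟩ :=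
    RegularFamily.exists_diffeomorph_image_eq_of_field_of_eigen hF hY hKc hband hKF hreg
      ((contDiff_w g).differentiable (by simp)) (continuous_roundingMult g).neg hfY
  refine ⟨?_, Φ, ?_, ?_, fun z => ?_⟩
  · -- `1/4` is a regular value of the rounded function: transversality at `τ = 1`
    have hΨ : ContDiff ℝ ∞ fun z : EuclideanSpace ℝ (Fin 4) =>
        ‖w g z‖ ^ 2 + Θ (‖cx z‖ ^ 2) + ε * ‖z‖ ^ 2 :=
      (((contDiff_norm_sq_complex.comp (contDiff_w g)).add
        (hΘ.comp (contDiff_norm_sq_complex.comp contDiff_cx))).add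
        (contDiff_const.mul (contDiff_norm_sq ℝ)))
    refine isRegularLevel_of_not_isMCriticalPt hΨ.contMDiff fun z hz => ?_
    have hz0 : F (1, z) = 0 := by
      rw [hFdef, roundingFamily_one]
      have hz' : ‖w g z‖ ^ 2 + Θ (‖cx z‖ ^ 2) + ε * ‖z‖ ^ 2 = 1 / 4 := hz
      linarith
    have hd := hreg 1 ⟨zero_le_one, le_rfl⟩ z hz0
    have hdiff1 : Differentiable ℝ fun q => F (1, q) :=
      (hF.comp (contDiff_const.prodMk contDiff_id)).differentiable (by simp)
    have hline := (hasDerivAt_comp_line hdiff1 z (roundingField g z)).add_const (1 / 4)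
    have hfun : (fun t : ℝ => F (1, z + t • roundingField g z) + 1 / 4) =
        fun t : ℝ => ‖w g (z + t • roundingField g z)‖ ^ 2 +
          Θ (‖cx (z + t • roundingField g z)‖ ^ 2) + ε * ‖z + t • roundingField g z‖ ^ 2 := by
      funext t
      rw [hFdef, roundingFamily_one]
      ring
    rw [hfun] at hline
    exact not_isMCriticalPt_of_hasDerivAt_line (hΨ.differentiable (by simp)) hline hd
  · have h0 : {z : EuclideanSpace ℝ (Fin 4) | F (0, z) ≤ 0} =
        {z | ‖w g z‖ ^ 2 + Θ (‖cx z‖ ^ 2) ≤ 1 / 4} := by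
      ext z
      simp only [mem_setOf_eq, hFdef, roundingFamily_zero]
      constructor <;> intro h <;> linarith
    have h1 : {z : EuclideanSpace ℝ (Fin 4) | F (1, z) ≤ 0} =
        {z | ‖w g z‖ ^ 2 + Θ (‖cx z‖ ^ 2) + ε * ‖z‖ ^ 2 ≤ 1 / 4} := by
      ext z
      simp only [mem_setOf_eq, hFdef, roundingFamily_one]
      constructor <;> intro h <;> linarith
    rw [h0, h1] at hle
    exact hle
  · have h0 : {z : EuclideanSpace ℝ (Fin 4) | F (0, z) = 0} =
        {z | ‖w g z‖ ^ 2 + Θ (‖cx z‖ ^ 2) = 1 / 4} := by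
      ext z
      simp only [mem_setOf_eq, hFdef, roundingFamily_zero]
      constructor <;> intro h <;> linarith
    have h1 : {z : EuclideanSpace ℝ (Fin 4) | F (1, z) = 0} =
        {z | ‖w g z‖ ^ 2 + Θ (‖cx z‖ ^ 2) + ε * ‖z‖ ^ 2 = 1 / 4} := by
      ext z
      simp only [mem_setOf_eq, hFdef, roundingFamily_one]
      constructor <;> intro h <;> linarith
    rw [h0, h1] at heq
    exact heq
  · obtain ⟨r, hr, hrz⟩ := heig z
    exact ⟨r, hr, by rw [hrz, Complex.real_smul]⟩

/-! ### §6 Rounding by an arbitrary non-negative perturbation `ε q` -/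

/-- **The general rounding family** `F(τ, z) = ‖w‖² + Θ(‖x‖²) + τ ε q(z) - 1/4` for a smooth
perturbation `q : ℝ⁴ → ℝ` (e.g. `q = ‖x‖² + δ χ(‖y‖²) ‖y‖²`, the perturbation wanted by the
Reeb-field computation on the model, which must stay split in `(w, x)` near the binding).
[folklore] -/
def roundingFamilyWith (g : ℕ) (Θ : ℝ → ℝ) (ε : ℝ) (q : EuclideanSpace ℝ (Fin 4) → ℝ)
    (p : ℝ × EuclideanSpace ℝ (Fin 4)) : ℝ :=
  ‖w g p.2‖ ^ 2 + Θ (‖cx p.2‖ ^ 2) + p.1 * (ε * q p.2) - 1 / 4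

section FamilyWith

variable (g : ℕ) {Θ : ℝ → ℝ} (ε : ℝ) {q : EuclideanSpace ℝ (Fin 4) → ℝ}

/-- Unfolding. [folklore] -/
theorem roundingFamilyWith_apply (τ : ℝ) (z : EuclideanSpace ℝ (Fin 4)) :
    roundingFamilyWith g Θ ε q (τ, z) = ‖w g z‖ ^ 2 + Θ (‖cx z‖ ^ 2) + τ * (ε * q z) - 1 / 4 :=
  rfl

/-- The general family is smooth when `Θ` and `q` are. [folklore] -/
theorem contDiff_roundingFamilyWith (hΘ : ContDiff ℝ ∞ Θ) (hq : ContDiff ℝ ∞ q) :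
    ContDiff ℝ ∞ (roundingFamilyWith g Θ ε q) := by
  unfold roundingFamilyWith
  have hs : ContDiff ℝ ∞ fun p : ℝ × EuclideanSpace ℝ (Fin 4) => ‖cx p.2‖ ^ 2 :=
    contDiff_norm_sq_complex.comp (contDiff_cx.comp contDiff_snd)
  exact ((((contDiff_norm_sq_complex.comp ((contDiff_w g).comp contDiff_snd)).add
    (hΘ.comp hs)).add (contDiff_fst.mul (contDiff_const.mul (hq.comp contDiff_snd)))).sub
      contDiff_const)

/-- The time derivative: `∂_τ F(τ, z) = ε q(z)`. [folklore] -/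
theorem fderiv_roundingFamilyWith_time (hΘ : ContDiff ℝ ∞ Θ) (hq : ContDiff ℝ ∞ q) (τ : ℝ)
    (z : EuclideanSpace ℝ (Fin 4)) :
    fderiv ℝ (roundingFamilyWith g Θ ε q) (τ, z) (1, 0) = ε * q z := by
  set c : ℝ := ε * q z with hc
  have h1 : HasDerivAt (fun σ : ℝ => roundingFamilyWith g Θ ε q (σ, z)) c τ := by
    have h : HasDerivAt (fun σ : ℝ => σ * c) c τ := by simpa using (hasDerivAt_id τ).mul_const c
    exact (h.const_add (‖w g z‖ ^ 2 + Θ (‖cx z‖ ^ 2))).sub_const (1 / 4)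
  have hFd : DifferentiableAt ℝ (roundingFamilyWith g Θ ε q) (τ, z) :=
    (contDiff_roundingFamilyWith g ε hΘ hq).differentiable (by simp) _
  have hcurve : HasDerivAt (fun σ : ℝ => ((σ, z) : ℝ × EuclideanSpace ℝ (Fin 4)))
      ((1 : ℝ), (0 : EuclideanSpace ℝ (Fin 4))) τ :=
    (hasDerivAt_id τ).prodMk (hasDerivAt_const τ z)
  have h2 : HasDerivAt ((roundingFamilyWith g Θ ε q) ∘
        fun σ : ℝ => ((σ, z) : ℝ × EuclideanSpace ℝ (Fin 4)))
      (fderiv ℝ (roundingFamilyWith g Θ ε q) (τ, z) ((1 : ℝ), (0 : EuclideanSpace ℝ (Fin 4)))) τ :=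
    hFd.hasFDerivAt.comp_hasDerivAt τ hcurve
  exact h2.unique h1

/-- **The derivative of the general `F_τ` along the rounding field**:
`-2m‖w‖² + Θ'(‖x‖²) D_x + τ ε dq(Y)`. [folklore] -/
theorem hasDerivAt_roundingFamilyWith_roundingField (hΘ : ContDiff ℝ ∞ Θ) (hq : ContDiff ℝ ∞ q)
    (τ : ℝ) (z : EuclideanSpace ℝ (Fin 4)) :
    HasDerivAt (fun t : ℝ => roundingFamilyWith g Θ ε q (τ, z + t • roundingField g z))
      (-(2 * roundingMult g z * ‖w g z‖ ^ 2) +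
        deriv Θ (‖cx z‖ ^ 2) * (2 * (conj (cx z) * roundingFieldX g z).re) +
        τ * (ε * fderiv ℝ q z (roundingField g z))) 0 := by
  set v := roundingField g z with hv
  have hw := hasDerivAt_norm_sq_w_roundingField g z
  have hx : HasDerivAt (fun t : ℝ => ‖cx (z + t • v)‖ ^ 2)
      (2 * (conj (cx z) * roundingFieldX g z).re) 0 :=
    hasDerivAt_norm_sq_cx_line z (roundingFieldX g z) (roundingFieldY g z)
  have h20 : ‖cx (z + (0 : ℝ) • v)‖ ^ 2 = ‖cx z‖ ^ 2 := by rw [zero_smul, add_zero]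
  have hΘ' : HasDerivAt (fun t : ℝ => Θ (‖cx (z + t • v)‖ ^ 2))
      (deriv Θ (‖cx z‖ ^ 2) * (2 * (conj (cx z) * roundingFieldX g z).re)) 0 := by
    have hd : HasDerivAt Θ (deriv Θ (‖cx (z + (0 : ℝ) • v)‖ ^ 2)) (‖cx (z + (0 : ℝ) • v)‖ ^ 2) :=
      ((hΘ.differentiable (by simp)) _).hasDerivAt
    have h := hd.comp 0 hx
    rwa [h20] at h
  have hqline : HasDerivAt (fun t : ℝ => q (z + t • v)) (fderiv ℝ q z v) 0 :=
    hasDerivAt_comp_line (hq.differentiable (by simp)) z v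
  exact ((hw.add hΘ').add ((hqline.const_mul ε).const_mul τ)).sub_const (1 / 4)

/-- The derivative along the rounding field as a value of the Fréchet derivative of the general
`F_τ`. [folklore] -/
theorem fderiv_roundingFamilyWith_roundingField (hΘ : ContDiff ℝ ∞ Θ) (hq : ContDiff ℝ ∞ q)
    (τ : ℝ) (z : EuclideanSpace ℝ (Fin 4)) :
    fderiv ℝ (fun p => roundingFamilyWith g Θ ε q (τ, p)) z (roundingField g z) =
      -(2 * roundingMult g z * ‖w g z‖ ^ 2) +
        deriv Θ (‖cx z‖ ^ 2) * (2 * (conj (cx z) * roundingFieldX g z).re) +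
        τ * (ε * fderiv ℝ q z (roundingField g z)) := by
  have hdiff : Differentiable ℝ fun p => roundingFamilyWith g Θ ε q (τ, p) :=
    ((contDiff_roundingFamilyWith g ε hΘ hq).comp (contDiff_const.prodMk contDiff_id)).differentiable
      (by simp)
  exact (hasDerivAt_comp_line hdiff z (roundingField g z)).unique
    (hasDerivAt_roundingFamilyWith_roundingField g ε hΘ hq τ z)

end FamilyWith

/-- **Rounding the base by `ε q` (form recording the support).**  As
`exists_diffeomorph_rounding_with` below, with the additional clause that the diffeomorphism is
the identity where `rho g > 3/8` (it is the time-one map of a flow supported in the compact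
`{rho g ≤ 3/8}`); used for its orientation-preservation (`DiffeomorphJacobianSign.lean`).
[folklore] -/
theorem exists_diffeomorph_rounding_with_far (g : ℕ) {Θ : ℝ → ℝ} (hΘ : ContDiff ℝ ∞ Θ)
    (hzero : ∀ s, s ≤ 4 → Θ s = 0) (hge : ∀ s, eta s ≤ Θ s) (hderiv : ∀ s, 0 ≤ deriv Θ s)
    {s₁ : ℝ} (hs₁ : Θ s₁ ≤ 1 / 32) (hpos : ∀ s, s₁ ≤ s → 0 < deriv Θ s)
    {q : EuclideanSpace ℝ (Fin 4) → ℝ} (hq : ContDiff ℝ ∞ q) (hq0 : ∀ z, 0 ≤ q z) :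
    ∃ ε₀ : ℝ, 0 < ε₀ ∧ ∀ ε : ℝ, 0 ≤ ε → ε ≤ ε₀ →
      IsRegularLevel (𝓡 4) (fun z => ‖w g z‖ ^ 2 + Θ (‖cx z‖ ^ 2) + ε * q z) (1 / 4) ∧
      ∃ Φ : EuclideanSpace ℝ (Fin 4) ≃ₘ⟮𝓘(ℝ, EuclideanSpace ℝ (Fin 4)),
          𝓘(ℝ, EuclideanSpace ℝ (Fin 4))⟯ EuclideanSpace ℝ (Fin 4),
        Φ '' {z | ‖w g z‖ ^ 2 + Θ (‖cx z‖ ^ 2) ≤ 1 / 4} =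
            {z | ‖w g z‖ ^ 2 + Θ (‖cx z‖ ^ 2) + ε * q z ≤ 1 / 4} ∧
          Φ '' {z | ‖w g z‖ ^ 2 + Θ (‖cx z‖ ^ 2) = 1 / 4} =
            {z | ‖w g z‖ ^ 2 + Θ (‖cx z‖ ^ 2) + ε * q z = 1 / 4} ∧
          (∀ z, ∃ r : ℝ, 0 < r ∧ w g (Φ z) = (r : ℂ) * w g z) ∧
          (∀ z, 3 / 8 < rho g z → Φ z = z) := by
  have hnonneg : ∀ s, 0 ≤ Θ s := fun s => (eta_nonneg s).trans (hge s)
  have hmono : Monotone Θ := monotone_of_deriv_nonneg (hΘ.differentiable (by simp)) hderiv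
  -- the compact sets `Ω₀ = {‖w‖² + Θ ≤ 1/4} ⊆ {rho ≤ 1/4}` and `W = Ω₀ ∩ {3/16 ≤ ‖w‖² + Θ}`
  set G : EuclideanSpace ℝ (Fin 4) → ℝ := fun z => ‖w g z‖ ^ 2 + Θ (‖cx z‖ ^ 2) with hG
  have hGc : Continuous G :=
    ((continuous_norm.comp (contDiff_w g).continuous).pow 2).add
      (hΘ.continuous.comp ((continuous_norm.comp contDiff_cx.continuous).pow 2))
  have hGρ : ∀ z, rho g z ≤ G z := fun z => by
    simp only [hG, rho]; linarith [hge (‖cx z‖ ^ 2)]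
  set Ω₀ : Set (EuclideanSpace ℝ (Fin 4)) := {z | G z ≤ 1 / 4} with hΩ₀
  have hΩ₀sub : Ω₀ ⊆ rho g ⁻¹' Iic (1 / 4) := fun z hz => (hGρ z).trans hz
  have hΩ₀c : IsCompact Ω₀ :=
    (isCompact_rho_le g).of_isClosed_subset (isClosed_le hGc continuous_const) hΩ₀sub
  set W : Set (EuclideanSpace ℝ (Fin 4)) := Ω₀ ∩ {z | 3 / 16 ≤ G z} with hW
  have hWc : IsCompact W := hΩ₀c.inter_right (isClosed_le continuous_const hGc)
  -- `h = 2m‖w‖² + 4Θ'‖x‖²‖y‖²` and its positive lower bound on `W`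
  set h : EuclideanSpace ℝ (Fin 4) → ℝ := fun z => 2 * roundingMult g z * ‖w g z‖ ^ 2 +
    4 * deriv Θ (‖cx z‖ ^ 2) * ‖cx z‖ ^ 2 * ‖cy z‖ ^ 2 with hh
  have hhc : Continuous h := by
    have h1 : Continuous fun z : EuclideanSpace ℝ (Fin 4) => ‖cx z‖ ^ 2 :=
      (continuous_norm.comp contDiff_cx.continuous).pow 2
    have h2 : Continuous fun z : EuclideanSpace ℝ (Fin 4) => ‖cy z‖ ^ 2 :=
      (continuous_norm.comp contDiff_cy.continuous).pow 2
    exact ((continuous_const.mul (continuous_roundingMult g)).mul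
      ((continuous_norm.comp (contDiff_w g).continuous).pow 2)).add
      (((continuous_const.mul ((hΘ.continuous_deriv (by simp)).comp h1)).mul h1).mul h2)
  have hhW : ∀ z ∈ W, 0 < h z := fun z hz =>
    h_pos g hzero hnonneg hmono hderiv hs₁ hpos hz.1 hz.2
  obtain ⟨h₀, hh₀, hh₀W⟩ : ∃ h₀, 0 < h₀ ∧ ∀ z ∈ W, h₀ ≤ h z := by
    by_cases hne : W.Nonempty
    · obtain ⟨z₀, hz₀, hmin⟩ := hWc.exists_isMinOn hne hhc.continuousOn
      exact ⟨h z₀, hhW z₀ hz₀, fun z hz => hmin hz⟩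
    · exact ⟨1, one_pos, fun z hz => (hne ⟨z, hz⟩).elim⟩
  -- the bound for `dq(Y)` on `Ω₀`
  set D : EuclideanSpace ℝ (Fin 4) → ℝ := fun z => fderiv ℝ q z (roundingField g z) with hD
  have hDc : Continuous D :=
    (hq.continuous_fderiv (by simp)).clm_apply (contDiff_roundingField g).continuous
  obtain ⟨B', hB'⟩ : ∃ B, ∀ z ∈ Ω₀, ‖D z‖ ≤ B :=
    hΩ₀c.exists_bound_of_continuousOn hDc.continuousOn
  set B : ℝ := max B' 0 with hBdef
  have hB : ∀ z ∈ Ω₀, ‖D z‖ ≤ B := fun z hz => (hB' z hz).trans (le_max_left _ _)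
  have hB0 : 0 ≤ B := le_max_right _ _
  -- a priori bound `q ≤ R₀` on `Ω₀`
  obtain ⟨R', hR'⟩ : ∃ R, ∀ z ∈ Ω₀, ‖q z‖ ≤ R :=
    hΩ₀c.exists_bound_of_continuousOn hq.continuous.continuousOn
  set R₀ : ℝ := max R' 1 with hR₀def
  have hR₀ : 0 < R₀ := lt_of_lt_of_le one_pos (le_max_right _ _)
  have hR : ∀ z ∈ Ω₀, q z ≤ R₀ := fun z hz =>
    ((le_abs_self _).trans (by simpa [Real.norm_eq_abs] using hR' z hz)).trans (le_max_left _ _)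
  -- the threshold
  set ε₀ : ℝ := min (1 / (16 * R₀)) (h₀ / (2 * (B + 1))) with hε₀
  have hε₀pos : 0 < ε₀ := lt_min (by positivity) (by positivity)
  refine ⟨ε₀, hε₀pos, fun ε hε hεε₀ => ?_⟩
  have hε1 : ε ≤ 1 / (16 * R₀) := hεε₀.trans (min_le_left _ _)
  have hε2 : ε ≤ h₀ / (2 * (B + 1)) := hεε₀.trans (min_le_right _ _)
  -- the data of the directed isotopy lemma
  set F := roundingFamilyWith g Θ ε q with hFdef
  have hF : ContDiff ℝ ∞ F := contDiff_roundingFamilyWith g ε hΘ hq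
  have hY : ContDiff ℝ ∞ (roundingField g) := contDiff_roundingField g
  have hKc : IsCompact (rho g ⁻¹' Iic (3 / 8)) := isCompact_rho_le_three_eighths g
  have hband : (0 : ℝ) < 1 / 8 := by norm_num
  have hKF : ∀ τ ∈ Icc (0 : ℝ) 1, ∀ z, |F (τ, z)| ≤ 1 / 8 → z ∈ rho g ⁻¹' Iic (3 / 8) := by
    intro τ hτ z hz
    have h1 := (abs_le.1 hz).2
    rw [hFdef, roundingFamilyWith_apply] at h1
    have h2 : 0 ≤ τ * (ε * q z) := mul_nonneg hτ.1 (mul_nonneg hε (hq0 z))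
    have h3 := hGρ z
    show rho g z ≤ 3 / 8
    simp only [hG] at h3
    linarith
  have hreg : ∀ τ ∈ Icc (0 : ℝ) 1, ∀ z, F (τ, z) = 0 →
      fderiv ℝ (fun p => F (τ, p)) z (roundingField g z) ≠ 0 := by
    intro τ hτ z hz0
    have hFz : ‖w g z‖ ^ 2 + Θ (‖cx z‖ ^ 2) + τ * (ε * q z) - 1 / 4 = 0 := by
      rw [hFdef, roundingFamilyWith_apply] at hz0; exact hz0
    have hτε : 0 ≤ τ * (ε * q z) := mul_nonneg hτ.1 (mul_nonneg hε (hq0 z))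
    have hzΩ : z ∈ Ω₀ := by
      show ‖w g z‖ ^ 2 + Θ (‖cx z‖ ^ 2) ≤ 1 / 4
      linarith
    have hzR : q z ≤ R₀ := hR z hzΩ
    have hsmall : τ * (ε * q z) ≤ 1 / 16 := by
      have h1 : τ * (ε * q z) ≤ 1 * (ε * q z) :=
        mul_le_mul_of_nonneg_right hτ.2 (mul_nonneg hε (hq0 z))
      have h2 : ε * q z ≤ 1 / (16 * R₀) * R₀ :=
        mul_le_mul hε1 hzR (hq0 z) (by positivity)
      have h3 : 1 / (16 * R₀) * R₀ = 1 / 16 := by field_simp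
      linarith
    have hzW : z ∈ W := by
      refine ⟨hzΩ, ?_⟩
      show 3 / 16 ≤ ‖w g z‖ ^ 2 + Θ (‖cx z‖ ^ 2)
      linarith
    have hw : ‖w g z‖ ^ 2 ≤ 1 / 4 := by linarith [hnonneg (‖cx z‖ ^ 2)]
    rw [hFdef, fderiv_roundingFamilyWith_roundingField g ε hΘ hq τ z,
      deriv_mul_two_mul_re_roundingFieldX g hzero hw]
    have hhz : h₀ ≤ h z := hh₀W z hzW
    have hDz : |D z| ≤ B := by simpa [Real.norm_eq_abs] using hB z hzΩ
    have hDle : D z ≤ B := (le_abs_self _).trans hDz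
    have hτD : τ * (ε * D z) ≤ ε * B := by
      have h1 : ε * D z ≤ ε * B := mul_le_mul_of_nonneg_left hDle hε
      rcases le_or_gt 0 (ε * D z) with h0 | h0
      · calc τ * (ε * D z) ≤ 1 * (ε * D z) := mul_le_mul_of_nonneg_right hτ.2 h0
          _ ≤ ε * B := by linarith
      · have : τ * (ε * D z) ≤ 0 := mul_nonpos_of_nonneg_of_nonpos hτ.1 h0.le
        have : 0 ≤ ε * B := mul_nonneg hε hB0
        linarith
    have hεB : ε * B ≤ h₀ / 2 := by
      have h1 : ε * B ≤ h₀ / (2 * (B + 1)) * B := mul_le_mul_of_nonneg_right hε2 hB0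
      have h2 : h₀ / (2 * (B + 1)) * B ≤ h₀ / (2 * (B + 1)) * (B + 1) :=
        mul_le_mul_of_nonneg_left (by linarith) (by positivity)
      have h3 : h₀ / (2 * (B + 1)) * (B + 1) = h₀ / 2 := by field_simp
      linarith
    have hval : -(2 * roundingMult g z * ‖w g z‖ ^ 2) +
        deriv Θ (‖cx z‖ ^ 2) * -(4 * ‖cx z‖ ^ 2 * ‖cy z‖ ^ 2) +
        τ * (ε * fderiv ℝ q z (roundingField g z)) = -h z + τ * (ε * D z) := by
      simp only [hh, hD]; ring
    rw [hval]
    linarith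
  have hfY : ∀ z, fderiv ℝ (w g) z (roundingField g z) = (-roundingMult g z) • w g z :=
    fderiv_w_roundingField g
  obtain ⟨Φ, hle, heq, hK', -, heig⟩ :=
    RegularFamily.exists_diffeomorph_image_eq_of_field_of_eigen hF hY hKc hband hKF hreg
      ((contDiff_w g).differentiable (by simp)) (continuous_roundingMult g).neg hfY
  refine ⟨?_, Φ, ?_, ?_, fun z => ?_, fun z hz => hK' z (not_le.2 hz)⟩
  · -- `1/4` is a regular value of the rounded function: transversality at `τ = 1`
    have hΨ : ContDiff ℝ ∞ fun z : EuclideanSpace ℝ (Fin 4) =>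
        ‖w g z‖ ^ 2 + Θ (‖cx z‖ ^ 2) + ε * q z :=
      (((contDiff_norm_sq_complex.comp (contDiff_w g)).add
        (hΘ.comp (contDiff_norm_sq_complex.comp contDiff_cx))).add (contDiff_const.mul hq))
    refine isRegularLevel_of_not_isMCriticalPt hΨ.contMDiff fun z hz => ?_
    have hz0 : F (1, z) = 0 := by
      rw [hFdef, roundingFamilyWith_apply]
      have hz' : ‖w g z‖ ^ 2 + Θ (‖cx z‖ ^ 2) + ε * q z = 1 / 4 := hz
      linarith
    have hd := hreg 1 ⟨zero_le_one, le_rfl⟩ z hz0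
    have hdiff1 : Differentiable ℝ fun p => F (1, p) :=
      (hF.comp (contDiff_const.prodMk contDiff_id)).differentiable (by simp)
    have hline := (hasDerivAt_comp_line hdiff1 z (roundingField g z)).add_const (1 / 4)
    have hfun : (fun t : ℝ => F (1, z + t • roundingField g z) + 1 / 4) =
        fun t : ℝ => ‖w g (z + t • roundingField g z)‖ ^ 2 +
          Θ (‖cx (z + t • roundingField g z)‖ ^ 2) + ε * q (z + t • roundingField g z) := by
      funext t
      rw [hFdef, roundingFamilyWith_apply]
      ring
    rw [hfun] at hline
    exact not_isMCriticalPt_of_hasDerivAt_line (hΨ.differentiable (by simp)) hline hd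
  · have h0 : {z : EuclideanSpace ℝ (Fin 4) | F (0, z) ≤ 0} =
        {z | ‖w g z‖ ^ 2 + Θ (‖cx z‖ ^ 2) ≤ 1 / 4} := by
      ext z
      simp only [mem_setOf_eq, hFdef, roundingFamilyWith_apply, zero_mul, add_zero]
      constructor <;> intro h <;> linarith
    have h1 : {z : EuclideanSpace ℝ (Fin 4) | F (1, z) ≤ 0} =
        {z | ‖w g z‖ ^ 2 + Θ (‖cx z‖ ^ 2) + ε * q z ≤ 1 / 4} := by
      ext z
      simp only [mem_setOf_eq, hFdef, roundingFamilyWith_apply, one_mul]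
      constructor <;> intro h <;> linarith
    rw [h0, h1] at hle
    exact hle
  · have h0 : {z : EuclideanSpace ℝ (Fin 4) | F (0, z) = 0} =
        {z | ‖w g z‖ ^ 2 + Θ (‖cx z‖ ^ 2) = 1 / 4} := by
      ext z
      simp only [mem_setOf_eq, hFdef, roundingFamilyWith_apply, zero_mul, add_zero]
      constructor <;> intro h <;> linarith
    have h1 : {z : EuclideanSpace ℝ (Fin 4) | F (1, z) = 0} =
        {z | ‖w g z‖ ^ 2 + Θ (‖cx z‖ ^ 2) + ε * q z = 1 / 4} := by
      ext z
      simp only [mem_setOf_eq, hFdef, roundingFamilyWith_apply, one_mul]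
      constructor <;> intro h <;> linarith
    rw [h0, h1] at heq
    exact heq
  · obtain ⟨r, hr, hrz⟩ := heig z
    exact ⟨r, hr, by rw [hrz, Complex.real_smul]⟩


/-- **Rounding the base by `ε q`, for an arbitrary smooth `q ≥ 0`, while multiplying `w` by a
positive function.**  Let `Θ : ℝ → ℝ` be smooth with `Θ = 0` on `s ≤ 4`, `Θ ≥ eta`, `Θ' ≥ 0`,
`Θ(s₁) ≤ 1/32` and `Θ' > 0` on `s ≥ s₁` for some `s₁`, and let `q : ℝ⁴ → ℝ` be smooth and
non-negative.  Then there is `ε₀ > 0` (depending on `q`) such that for every `ε ∈ [0, ε₀]`: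
`1/4` is a regular value of `‖w‖² + Θ(‖x‖²) + ε q`, and some diffeomorphism `Φ` of `ℝ⁴ = ℂ²`
satisfies `Φ {‖w‖² + Θ(‖x‖²) ≤ 1/4} = {‖w‖² + Θ(‖x‖²) + ε q ≤ 1/4}`,
`Φ {‖w‖² + Θ(‖x‖²) = 1/4} = {‖w‖² + Θ(‖x‖²) + ε q = 1/4}` and `w(Φ z) = r w(z)`, `r > 0`,
for every `z`.  Same proof as `exists_diffeomorph_rounding` (only `q ≥ 0`, a bound for `q` and
for `dq(Y)` on the compact `{‖w‖² + Θ ≤ 1/4}` are used). [folklore] -/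
theorem exists_diffeomorph_rounding_with (g : ℕ) {Θ : ℝ → ℝ} (hΘ : ContDiff ℝ ∞ Θ)
    (hzero : ∀ s, s ≤ 4 → Θ s = 0) (hge : ∀ s, eta s ≤ Θ s) (hderiv : ∀ s, 0 ≤ deriv Θ s)
    {s₁ : ℝ} (hs₁ : Θ s₁ ≤ 1 / 32) (hpos : ∀ s, s₁ ≤ s → 0 < deriv Θ s)
    {q : EuclideanSpace ℝ (Fin 4) → ℝ} (hq : ContDiff ℝ ∞ q) (hq0 : ∀ z, 0 ≤ q z) :
    ∃ ε₀ : ℝ, 0 < ε₀ ∧ ∀ ε : ℝ, 0 ≤ ε → ε ≤ ε₀ →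
      IsRegularLevel (𝓡 4) (fun z => ‖w g z‖ ^ 2 + Θ (‖cx z‖ ^ 2) + ε * q z) (1 / 4) ∧
      ∃ Φ : EuclideanSpace ℝ (Fin 4) ≃ₘ⟮𝓘(ℝ, EuclideanSpace ℝ (Fin 4)),
          𝓘(ℝ, EuclideanSpace ℝ (Fin 4))⟯ EuclideanSpace ℝ (Fin 4),
        Φ '' {z | ‖w g z‖ ^ 2 + Θ (‖cx z‖ ^ 2) ≤ 1 / 4} =
            {z | ‖w g z‖ ^ 2 + Θ (‖cx z‖ ^ 2) + ε * q z ≤ 1 / 4} ∧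
          Φ '' {z | ‖w g z‖ ^ 2 + Θ (‖cx z‖ ^ 2) = 1 / 4} =
            {z | ‖w g z‖ ^ 2 + Θ (‖cx z‖ ^ 2) + ε * q z = 1 / 4} ∧
          ∀ z, ∃ r : ℝ, 0 < r ∧ w g (Φ z) = (r : ℂ) * w g z := by
  obtain ⟨ε₀, hε₀, H⟩ := exists_diffeomorph_rounding_with_far g hΘ hzero hge hderiv hs₁ hpos hq hq0
  refine ⟨ε₀, hε₀, fun ε hε hεε₀ => ?_⟩
  obtain ⟨hreg, Φ, hle, heq, hw, -⟩ := H ε hε hεε₀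
  exact ⟨hreg, Φ, hle, heq, hw⟩

end LefschetzBase

end Literature.Topology.FourManifolds

end
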